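import Literature.NumberTheory.EllipticCurves.IwasawaTwistModPTowerExact
import Literature.NumberTheory.EllipticCurves.KummerSelmerStructure
import HarnessLib

/-!
# Step 0 of the `μ`-transfer core (`stub_coreX9`, crux 19276 `MuTransferX9`): the `Ω`-adic class

HOME/koly/MU-TRANSFER-PROOF.md §5, Step 0 / CORE-PLAN S0.6–S0.7, on the GENUINE objects: in the
`Ω = 𝔽_p[[T]]`-adic Iwasawa cohomology `𝐇¹_Ω := ZpExtension.twistTower` of `E[p]` (compatible
families in `H¹(F, 𝒯_J(E))`, `𝒯_J = E[p] ⊗ 𝔽_p[T]/T^J (χ_κ)`), every non-zero class `t` is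
`T^a κ'` with `κ' ∉ T·𝐇¹_Ω`, and then the constant coefficient `κ̄' ∈ H¹(F, E[p])` of `κ'` is
non-zero — because `𝐇¹_Ω` is `T`-separated (`exists_iterate_eq_and_not_mem_range`) and
`ker(𝐇¹_Ω → H¹(F, E[p])) = T·𝐇¹_Ω` (`towerConst_ne_zero_of_not_mem_range`), the latter needing
`E[p]^{Γ_F} = 0`, which is supplied here from irreducibility of `E[p]` (`#E[p] = p² ≠ p`).

PARTITION (D-0054): X9 (A4) — helper toward `stub_coreX9`; closes none.
-/

set_option linter.dupNamespace false

noncomputable section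

open Literature.NumberTheory.EllipticCurves Literature.NumberTheory.GaloisRepresentations Field

universe u

namespace Summit.BirchSwinnertonDyer.BirchSwinnertonDyer.Rank1Residual.LevelE

variable {F : Type u} [Field F] [CharZero F] (W : WeierstrassCurve F) [W.IsElliptic] (p : ℕ)
  [Fact p.Prime]

/-- **`E[p]^{Γ_F} = 0` when `E[p]` is irreducible**: a non-zero `Γ_F`-fixed point `P` generates a
`Γ_F`-stable subgroup `ℤ·P ≠ ⊥`, hence `= ⊤` by irreducibility, of order `p`; but `#E[p] = p²`.
[cite: Serre1972, §4] [cite: SilvermanAEC2009, Cor. III.6.4(b)] -/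
theorem geomTorsion_eq_zero_of_forall_smul_eq_of_irr (hirr : W.HasIrreducibleModPGaloisRep p)
    {P : WeierstrassCurve.geomTorsion W (p : ℤ)} (hP : ∀ σ : absoluteGaloisGroup F, σ • P = P) :
    P = 0 := by
  have hp : p.Prime := Fact.out
  by_contra hP0
  have hstab : ∀ σ : absoluteGaloisGroup F, ∀ Q ∈ AddSubgroup.zmultiples P,
      σ • Q ∈ AddSubgroup.zmultiples P := by
    intro σ Q hQ
    obtain ⟨k, rfl⟩ := AddSubgroup.mem_zmultiples_iff.mp hQ
    rw [← WeierstrassCurve.torsionGaloisModule_apply_apply, map_zsmul,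
      WeierstrassCurve.torsionGaloisModule_apply_apply, hP σ]
    exact AddSubgroup.zsmul_mem _ (AddSubgroup.mem_zmultiples P) k
  rcases hirr (AddSubgroup.zmultiples P) hstab with h | h
  · exact hP0 ((AddSubgroup.eq_bot_iff_forall _).mp h P (AddSubgroup.mem_zmultiples P))
  · have horder : addOrderOf P = p :=
      addOrderOf_eq_prime (AddSubgroup.torsionBy.nsmul P) hP0
    have h1 : Nat.card (AddSubgroup.zmultiples P) = p := by rw [Nat.card_zmultiples, horder]
    rw [h, AddSubgroup.card_top,
      W.natCard_geomTorsion (n := (p : ℤ)) (by exact_mod_cast hp.ne_zero), Int.natAbs_natCast] at h1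
    have h2 : p < p ^ 2 := by
      calc p = p * 1 := (mul_one p).symm
        _ < p * p := Nat.mul_lt_mul_of_pos_left hp.one_lt hp.pos
        _ = p ^ 2 := (sq p).symm
    exact absurd h1 h2.ne'

/-- The same in the form consumed by the `Ω`-adic tower lemmas (`hinv` of
`ZpExtension.shiftEmbedH1_injective` / `towerConst_ne_zero_of_not_mem_range`): no non-zero vector
of `E[p]` is fixed by the representation `W.torsionGaloisModule p`. [cite: Serre1972, §4] -/
theorem torsionGaloisModule_fixed_eq_zero_of_irr (hirr : W.HasIrreducibleModPGaloisRep p) :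
    ∀ m : WeierstrassCurve.geomTorsion W (p : ℤ),
      (∀ σ : absoluteGaloisGroup F, W.torsionGaloisModule (p : ℤ) σ m = m) → m = 0 :=
  fun _ hm => geomTorsion_eq_zero_of_forall_smul_eq_of_irr W p hirr fun σ => hm σ

/-- **Step 0 output (MU-TRANSFER-PROOF §5 Step 0, on genuine objects).** For `κ : ZpExtension F p`
and `E[p]` irreducible: every non-zero `t ∈ 𝐇¹_Ω = twistTower` is `T^a κ'` for some `a` and some
`κ' ∉ T·𝐇¹_Ω`, whose constant coefficient `κ̄' = towerConst κ' ∈ H¹(F, E[p])` is non-zero.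
[cite: MazurRubin2004, §5.3] [cite: Serre1972, §4] -/
theorem exists_towerShift_iterate_eq_and_towerConst_ne_zero (κ : ZpExtension F p)
    (hirr : W.HasIrreducibleModPGaloisRep p)
    {t : κ.twistTower (W.torsionGaloisModule (p : ℤ))
      (fun P : WeierstrassCurve.geomTorsion W (p : ℤ) => AddSubgroup.torsionBy.nsmul P)}
    (ht : t ≠ 0) :
    ∃ (a : ℕ) (y : κ.twistTower (W.torsionGaloisModule (p : ℤ))
        (fun P : WeierstrassCurve.geomTorsion W (p : ℤ) => AddSubgroup.torsionBy.nsmul P)),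
      (κ.towerShift (W.torsionGaloisModule (p : ℤ)) (fun P => AddSubgroup.torsionBy.nsmul P))^[a] y
          = t ∧
      (∀ z, κ.towerShift (W.torsionGaloisModule (p : ℤ)) (fun P => AddSubgroup.torsionBy.nsmul P) z
          ≠ y) ∧
      κ.towerConst (W.torsionGaloisModule (p : ℤ)) (fun P => AddSubgroup.torsionBy.nsmul P) y ≠ 0 := by
  obtain ⟨a, y, hy, hnr⟩ := κ.exists_iterate_eq_and_not_mem_range (W.torsionGaloisModule (p : ℤ))
    (fun P => AddSubgroup.torsionBy.nsmul P) ht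
  exact ⟨a, y, hy, hnr, κ.towerConst_ne_zero_of_not_mem_range (W.torsionGaloisModule (p : ℤ))
    (fun P => AddSubgroup.torsionBy.nsmul P) (torsionGaloisModule_fixed_eq_zero_of_irr W p hirr) hnr⟩

end Summit.BirchSwinnertonDyer.BirchSwinnertonDyer.Rank1Residual.LevelE

end
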